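import Summits.CriticalPhenomena.Ising3D.ExclusionSentencesControl2DTrgGammaEps

/-!
# Exclusion sentences — 2D-control instance of the FULL `TRG` checker at `Δ_ε = 1`, part 2 of 2
(cell `pub-ising3x`, seat recog-1)

HONEST FRAMING: lottery ticket; floor = tightest certified 3D Ising CFT bounds; no exact-solution
claim without a proof.

Parts `4–7`, the assembled sentence `trgFull_control_eps` and the printed shape `control_eps_trgFull` (a member of the
whole FAMILIES-v1 `TRG` table within `10⁻⁵` of `1` is one of the five tuples of `controlEpsTrgGEx`, part 1).
No 3D digit is used anywhere.
-/

namespace Summit.CriticalPhenomena.Ising3D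

/-- Part 4 of the full-TRG sentence on `[1 − 10⁻⁵, 1 + 10⁻⁵]`. -/
theorem trgFull_control_eps_p4 :
    trgFullPart 17 32 4 (1 - 1 / 10 ^ 5) (1 + 1 / 10 ^ 5) controlEpsTrgGEx = true := by
  decide +kernel

/-- Part 5 of the full-TRG sentence on `[1 − 10⁻⁵, 1 + 10⁻⁵]`. -/
theorem trgFull_control_eps_p5 :
    trgFullPart 17 32 5 (1 - 1 / 10 ^ 5) (1 + 1 / 10 ^ 5) controlEpsTrgGEx = true := by
  decide +kernel

/-- Part 6 of the full-TRG sentence on `[1 − 10⁻⁵, 1 + 10⁻⁵]`. -/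
theorem trgFull_control_eps_p6 :
    trgFullPart 17 32 6 (1 - 1 / 10 ^ 5) (1 + 1 / 10 ^ 5) controlEpsTrgGEx = true := by
  decide +kernel

/-- Part 7 of the full-TRG sentence on `[1 − 10⁻⁵, 1 + 10⁻⁵]`. -/
theorem trgFull_control_eps_p7 :
    trgFullPart 17 32 7 (1 - 1 / 10 ^ 5) (1 + 1 / 10 ^ 5) controlEpsTrgGEx = true := by
  decide +kernel

/-- **Full-TRG sentence at the 2D control, `Δ_ε = 1`**: the five listed tuples are the COMPLETE member list of
FAMILIES-v1 `TRG` (`D ≤ 17`, `h ≤ 32`) within `10⁻⁵` of `1`. -/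
theorem trgFull_control_eps :
    trgFullExcluded 17 32 (1 - 1 / 10 ^ 5) (1 + 1 / 10 ^ 5) controlEpsTrgGEx = true :=
  trgFullExcluded_of_parts trgFull_control_eps_p0 trgFull_control_eps_p1 trgFull_control_eps_p2
    trgFull_control_eps_p3 trgFull_control_eps_p4 trgFull_control_eps_p5 trgFull_control_eps_p6
    trgFull_control_eps_p7

/-- Printed shape: a real within `10⁻⁵` of `1` that is a member of the whole TRG table equals one of the five listed
monomials. -/
theorem control_eps_trgFull {x : ℝ}
    (hx : ((1 - 1 / 10 ^ 5 : ℚ) : ℝ) ≤ x ∧ x ≤ ((1 + 1 / 10 ^ 5 : ℚ) : ℝ)) (hm : x ∈ trgFullFamily 17 32) :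
    ∃ e ∈ controlEpsTrgGEx, x = trgGTupleVal e :=
  trgFullExcluded_sound trgFull_control_eps hx hm

end Summit.CriticalPhenomena.Ising3D
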